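import Summits.QuantumFields.YangMills.Theorems.BalabanUVNodesK0Stub1BHolds
import HarnessLib

/-!
# K0⁷ V23 — STUB 1ᴮ CLOSED BY NAME AND SIGNATURE (the №370 (2) ∕ №372 FALLBACK CLOSER, A8 form: `--supports` WITHOUT `--as helper`): `∀ F : T4Family, K0V23Defs.Prop8StepCoPGridGBAt F` restated under the by-name-closer basename and proved by the landed
# supplier `K0Stub1BHolds.prop8StepCoPGridGBAt_holds_all` (✓p767981)

Cell `pub-ymgap`, seat `pub-ymgap-dag-n07-e` g35 (FAN-OUT §N07 row s3 lineage; director-ym №372 I.18244: TONIGHT'S FALLBACK FILER-OF-RECORD #1).  `--kind proof --supports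
stmt-QuantumFields-20541 --as helper` (K0⁷); count-neutral.  FILED on the plan seat's №367 runbook LAST LINE «FALLBACK NEEDED» (I.19472, 16:06:37Z): after the V23 skeleton
`K0Skeleton13SepCoPHV23` d01c50abc247f5ff was REGISTERED (16:05:37Z), the gate's stub table did NOT read `stub_prop8StepCoPGridGB13 : ∀ F, K0V23Defs.Prop8StepCoPGridGBAt F` as matched by the landed
statement of `K0Stub1BHolds.prop8StepCoPGridGBAt_holds_all` (gate8 R563∕R565 (Q1)∕(Q3), director-ym №370: the `dedup.landed` rule is waived in the stub-closer case only).
[15] = [Balaban1985Variational]; [II] = [Balaban1984PropagatorsII]; [III] = [Balaban1988Convergent].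

WHAT IS PROVED (sorry-free; no definition; axioms standard).  `stub_prop8StepCoPGridGB13 : ∀ F : T4Family, Prop8StepCoPGridGBAt F` — NAME + SIGNATURE EXACTLY AS REGISTERED
(V23 skeleton `K0Skeleton13SepCoPHV23` d01c50abc247f5ff l.57, registered on K0⁷ 2026-08-30T16:05:37Z by plan g97; the gate: «each `propose --supports stmt-QuantumFields-20541` must prove a
registered stub by name + signature») — — the V23 stub-1 text, [15]
Proposition 8's grid-guarded top step over print's [II] (2.3) datum `lamDatum F` and print's (7) data `dataSmall7LamTopOf F 2` for `N = 2`, for every four-torus family — by the landed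
supplier `K0Stub1BHolds.prop8StepCoPGridGBAt_holds_all` (itself `N07Prop8StepCoPGridGAtLam.exists_prop8RegSepTopStepGB_lam F 1 le_rfl`, ✓p767364, the S1c chain end to end: dag-n05-e's
record crown → ✓140 thm 1 → 125′ → 124′ → 123′ → 122′ → the F0c token).
HONEST SCOPE (binding).  A by-name restatement; zero new content.  It CLOSES NOTHING by itself: the close of `stub_prop8StepCoPGridGB13` is a ledger act on the registered V23 skeleton;
K0⁷ stays OPEN (stub 3ᴬ′ᴮ `AbsBetaBoxAtThm1WitnessCCMGenGridGZBAt` — the sign-free |β| box at the print-regime Z3 member — and the composition remain); N07 NOT discharged; counts unmoved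
(typed 28∕28 · discharged 8∕28); one finite 𝕋⁴ programme at fixed ε — the route closes the conditional finite-𝕋⁴ rung `BalabanLadder.UV` ONLY; nothing continuum ∕ ℝ⁴ ∕ OS; the
Yang–Mills mass gap (Clay) is NOT proved by any of this.  No `def`, no `instance`, no `notation`, no `sorry`.

References: [15] Prop. 8 p. 304, (7) p. 278; [II] (2.3) p. 224; [III] (2.5) p. 255, (2.10) p. 256.
-/

set_option autoImplicit false

noncomputable section

namespace Summit.QuantumFields.YangMills.Theorems.K0V23Stub1Closer

open Literature.MathematicalPhysics.QuantumFieldTheory.Balaban1983to89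
open Literature.MathematicalPhysics.QuantumFieldTheory.Balaban1983to89.T4Continuum
open Summit.QuantumFields.YangMills.Theorems.K0V23Defs (Prop8StepCoPGridGBAt)

/-- **`stub_prop8StepCoPGridGB13` — THE REGISTERED V23 STUB 1ᴮ, BY NAME AND SIGNATURE**: `∀ F : T4Family, Prop8StepCoPGridGBAt F` — [15] Proposition 8's grid-guarded top step over print's [II] (2.3) datum and print's (7) data
(`N = 2`), for every four-torus family; proof = the landed supplier `K0Stub1BHolds.prop8StepCoPGridGBAt_holds_all`. [cite: Balaban1985Variational, Prop. 8 p.304, (7) p.278; Balaban1984PropagatorsII, (2.3) p.224; Balaban1988Convergent, (2.5) p.255, (2.10) p.256] -/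
theorem stub_prop8StepCoPGridGB13 : ∀ F : T4Family, Prop8StepCoPGridGBAt F :=
  Summit.QuantumFields.YangMills.BalabanUVNodes.K0Stub1BHolds.prop8StepCoPGridGBAt_holds_all

end Summit.QuantumFields.YangMills.Theorems.K0V23Stub1Closer

end
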